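import Mathlib
import Summits.ABC.ABC.Theses.CongruentialReceptacle
import Summits.ABC.ABC.Theorems.ReceptacleIdentity.Negative.TameLocalReceptacleResidueFreeLemmas

/-!
# Disproof work file for crux `TameLocalReceptacle` (stmt-ABC-14354) — cdisprove cycle 1

(findings index — see the docstrings below; prose only in docstrings)

* §1 `memberSum` decomposition: the crux's sum over `p ∣ abc` is `A(a; b) + B(b; a) + C(c; a)` — three MEMBER
  TERMS, each a function of (member, partner mod rad(member)).  PROVED (`tameSum_eq_members`, `aPart_congr`, …).
* §2 `aPart_lower`: the lower window summed over ONE member (value bookkeeping of designs).  PROVED.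
* §3 the certificate format (DESIGN = Farkas certificate over a symbolic `(2^K,3^J)`-binary-form family) and
  the COMPUTATIONAL RECORD: LP optimum 0 on the linear family, on ALL quadratic forms (|coeff| ≤ 6, 8 ratio
  regimes), on all small cubic/quartic forms and structured universes; complete single-negative searches in
  degrees 2–4 end at value exactly `0 − O(ε)`; extremal-zoo recombination empty.
* §4 structural no-go facts (C-privacy; counting rule + monomial rigidity; pencil Riemann–Hurwitz).
* §5 near misses (the Fermat-pencil borderline family in every degree; near-minimality of any table on
  `(2^K, 3^J − 2^K, 3^J)`).
* §6 line `SketchIdeator1`: complete modulo EH (all stubs landed by the lead); EH not cheaply refutable.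
* §7 tightness (landed separately): `not_tlrWindow_of_lt_six` — the lower-window constant `6` is sharp.
VERDICT OF THE CYCLE: no kill; the crux resists every cheap attack and every finite symbolic certificate of
degree ≤ 4; it is refuted modulo EH (line) and window-sharp.
-/

set_option linter.dupNamespace false

open Finset Literature.NumberTheory.DiophantineGeometry

namespace Summit.ABC.ABC.Cruxes.TameLocalReceptacle.Disproof

/-! ## §1 Member-term decomposition of the receptacle sum -/

/-- The crux's sum `Σ_{p ∣ abc} t(p; v_p a, v_p b, v_p c; a' mod p, b' mod p, c' mod p)` (literally). -/
noncomputable def tameSum (t : ℕ → ℕ → ℕ → ℕ → ℕ → ℕ → ℕ → ℤ) (a b c : ℕ) : ℤ :=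
  ∑ p ∈ (a * b * c).primeFactors, t p (a.factorization p) (b.factorization p) (c.factorization p)
    (a / p ^ a.factorization p % p) (b / p ^ b.factorization p % p) (c / p ^ c.factorization p % p)

/-- The A-member term: `Σ_{p ∣ a} t(p; v_p a, 0, 0; a' mod p, b mod p, c mod p)`. -/
noncomputable def aPart (t : ℕ → ℕ → ℕ → ℕ → ℕ → ℕ → ℕ → ℤ) (a b c : ℕ) : ℤ :=
  ∑ p ∈ a.primeFactors, t p (a.factorization p) 0 0 (a / p ^ a.factorization p % p) (b % p) (c % p)

/-- The B-member term. -/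
noncomputable def bPart (t : ℕ → ℕ → ℕ → ℕ → ℕ → ℕ → ℕ → ℤ) (a b c : ℕ) : ℤ :=
  ∑ p ∈ b.primeFactors, t p 0 (b.factorization p) 0 (a % p) (b / p ^ b.factorization p % p) (c % p)

/-- The C-member term. -/
noncomputable def cPart (t : ℕ → ℕ → ℕ → ℕ → ℕ → ℕ → ℕ → ℤ) (a b c : ℕ) : ℤ :=
  ∑ p ∈ c.primeFactors, t p 0 0 (c.factorization p) (a % p) (b % p) (c / p ^ c.factorization p % p)

/-- **Member decomposition.** On a pairwise coprime positive triple the receptacle sum is the sum of the three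
member terms. -/
theorem tameSum_eq_parts (t : ℕ → ℕ → ℕ → ℕ → ℕ → ℕ → ℕ → ℤ) {a b c : ℕ} (ha : 0 < a) (hb : 0 < b)
    (hc : 0 < c) (hab : Nat.Coprime a b) (hac : Nat.Coprime a c) (hbc : Nat.Coprime b c) :
    tameSum t a b c = aPart t a b c + bPart t a b c + cPart t a b c := by
  unfold tameSum aPart bPart cPart
  have h := Summit.ABC.ABC.Theorems.ReceptacleIdentity.Negative.sum_primeFactors_triple
    (fun p i j k => t p i j k (a / p ^ i % p) (b / p ^ j % p) (c / p ^ k % p)) ha hb hc hab hac hbc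
  simp only [pow_zero, Nat.div_one] at h
  exact h

/-- For an abc-triple the hypotheses of `tameSum_eq_parts` hold. -/
theorem tameSum_eq_parts_of_abc (t : ℕ → ℕ → ℕ → ℕ → ℕ → ℕ → ℕ → ℤ) {a b c : ℕ}
    (h : IsABCTriple a b c) :
    tameSum t a b c = aPart t a b c + bPart t a b c + cPart t a b c := by
  obtain ⟨ha, hb, habc, hcop⟩ := h
  have hc : 0 < c := by omega
  have hac : Nat.Coprime a c := by
    rw [← habc]; exact Nat.coprime_self_add_right.mpr hcop
  have hbc : Nat.Coprime b c := by
    rw [← habc]; exact Nat.coprime_add_self_right.mpr hcop.symm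
  exact tameSum_eq_parts t ha hb hc hcop hac hbc

/-! ### Node equality: a member term sees the partner only modulo the primes of the member -/

/-- The A-term of `a` depends on `(b, c)` only through their residues modulo the primes of `a`. -/
theorem aPart_congr (t : ℕ → ℕ → ℕ → ℕ → ℕ → ℕ → ℕ → ℤ) {a b c b' c' : ℕ}
    (hb : ∀ p ∈ a.primeFactors, b % p = b' % p) (hc : ∀ p ∈ a.primeFactors, c % p = c' % p) :
    aPart t a b c = aPart t a b' c' := by
  unfold aPart
  exact Finset.sum_congr rfl fun p hp => by rw [hb p hp, hc p hp]

/-- The B-term of `b` depends on `(a, c)` only through their residues modulo the primes of `b`. -/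
theorem bPart_congr (t : ℕ → ℕ → ℕ → ℕ → ℕ → ℕ → ℕ → ℤ) {a b c a' c' : ℕ}
    (ha : ∀ p ∈ b.primeFactors, a % p = a' % p) (hc : ∀ p ∈ b.primeFactors, c % p = c' % p) :
    bPart t a b c = bPart t a' b c' := by
  unfold bPart
  exact Finset.sum_congr rfl fun p hp => by rw [ha p hp, hc p hp]

/-- The C-term of `c` depends on `(a, b)` only through their residues modulo the primes of `c`. -/
theorem cPart_congr (t : ℕ → ℕ → ℕ → ℕ → ℕ → ℕ → ℕ → ℤ) {a b c a' b' : ℕ}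
    (ha : ∀ p ∈ c.primeFactors, a % p = a' % p) (hb : ∀ p ∈ c.primeFactors, b % p = b' % p) :
    cPart t a b c = cPart t a' b' c := by
  unfold cPart
  exact Finset.sum_congr rfl fun p hp => by rw [ha p hp, hb p hp]

/-- Residues agree modulo every prime of `m` as soon as they agree modulo a multiple `M` of `rad m`
(used with `M` = a known divisor chain, e.g. `M = ℓ(U,V)` for a member `ℓ(U,V)^4`). -/
theorem mod_eq_of_modEq_of_primes_dvd {m M x y : ℕ} (hM : ∀ p ∈ m.primeFactors, p ∣ M)
    (h : x ≡ y [MOD M]) : ∀ p ∈ m.primeFactors, x % p = y % p := by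
  intro p hp
  exact (Nat.ModEq.of_dvd (hM p hp) h)

/-! ## §2 Summed lower window of ONE member (the value bookkeeping of a design) -/

/-- `log n = ∑_{p ∣ n} ν_p(n) · log p` for `n ≠ 0`. -/
theorem log_eq_sum_factorization_log' {n : ℕ} (hn : n ≠ 0) :
    Real.log n = ∑ p ∈ n.primeFactors, (n.factorization p : ℝ) * Real.log p := by
  conv_lhs => rw [Nat.prod_primeFactors_pow_factorization hn]
  push_cast
  rw [Real.log_prod]
  · exact Finset.sum_congr rfl fun p _ => by rw [Real.log_pow]
  · intro p hp
    exact pow_ne_zero _ (by exact_mod_cast (Nat.prime_of_mem_primeFactors hp).ne_zero)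

/-- **Member lower bound.** Under the lower window, the A-term of a member `a` is at least
`c₁ (2 log a − (6+ε) Σ_{p ∣ a} log p) = c₁ (2 log a − (6+ε) log rad a)`; for a member with known partial
factorisation `a = ∏ f_i^{e_i}` this is `≥ c₁ Σ_i (2 e_i − 6 − ε) log f_i − O(1)`, i.e. in units of the
log-scale, `λ(a) = 2·deg − (6+ε)·(degree of the generic radical)` — the bookkeeping behind every value
computation in §3–§5.  (Same statement for `bPart`, `cPart`.) -/
theorem aPart_lower {ε c₁ : ℝ} {t : ℕ → ℕ → ℕ → ℕ → ℕ → ℕ → ℕ → ℤ}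
    (hw : ∀ p i j k r s z : ℕ, p.Prime →
      c₁ * (2 * ((i + j + k : ℕ) : ℝ) - 6 - ε) * Real.log p ≤ (t p i j k r s z : ℝ))
    {a : ℕ} (ha : a ≠ 0) (b c : ℕ) :
    c₁ * (2 * Real.log a - (6 + ε) * ∑ p ∈ a.primeFactors, Real.log p) ≤ (aPart t a b c : ℝ) := by
  have hcast : (aPart t a b c : ℝ) = ∑ p ∈ a.primeFactors,
      (t p (a.factorization p) 0 0 (a / p ^ a.factorization p % p) (b % p) (c % p) : ℝ) := by
    unfold aPart; push_cast; rfl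
  have hlhs : c₁ * (2 * Real.log a - (6 + ε) * ∑ p ∈ a.primeFactors, Real.log p)
      = ∑ p ∈ a.primeFactors, c₁ * (2 * ((a.factorization p + 0 + 0 : ℕ) : ℝ) - 6 - ε) * Real.log p := by
    rw [log_eq_sum_factorization_log' ha, Finset.mul_sum, Finset.mul_sum, ← Finset.sum_sub_distrib,
      Finset.mul_sum]
    refine Finset.sum_congr rfl fun p _ => ?_
    push_cast; ring
  rw [hcast, hlhs]
  exact Finset.sum_le_sum fun p hp => hw p _ _ _ _ _ _ (Nat.prime_of_mem_primeFactors hp)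

/-! ## §3 The certificate format and the computational record (docstring; no Lean content)

A DESIGN over a symbolic family (here: abc-triples whose members are integral binary forms in
`U = 2^K`, `V = 3^J`, instantiated along `K → ∞` with `V/U` in a fixed window — `exists_balanced_pow`-type
walks give infinitely many such `(K,J)`) is a finitely supported `σ : triples → ℤ` such that
(i) every member-term `(position, member x, partner mod m(x))` — `m(x)` = product of the distinct generic
irreducible factors of `x` times the constant primes of `x`; by `aPart_congr`/`bPart_congr`/`cPart_congr`
two triples with the same key have literally the same term — has net multiplicity `≥ 0`, and
(ii) `value(σ) := Σ_T σ_T · (6·deg − (6+ε)·r_gen(T)) > 0`, `r_gen(T)` = total degree of the generic radical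
of `abc` (pure factors `U, V` cost nothing: `aPart_lower` with `2·v_2(U^i) − 6` at the single prime `2`).
A design refutes the crux: at a prime modulus `ℓ` above every member and `n` large the congruences are
identities (`tameSum = B_T`, `|B_T| ≤ c₃`), so `Σ σ_T·tameSum(T) ≤ c₃‖σ‖₁`, while by (i), the lower window
and `aPart_lower`, `Σ σ_T·tameSum(T) ≥ c₁·value(σ)·log U − O_σ(1) → ∞`.  Conversely (LP duality) a family
carries NO design iff it carries a consistent real "table" `τ(key) ≥ λ(key)` with `Σ_{keys of T} τ = 0`.

RECORD (2026-08-16; scripts `lp2/*.py` of the disprover's folder, kit jobs cited):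
* linear forms `αU+βV`, |coeff| ≤ 8, five ratio regimes: LP optimum 0 — no design [j018702]; dual tables
  take values `{2, −4, 8}` = `λ + 6·{0,1,2}` [j018717].
* ALL binary quadratic forms, |coeff| ≤ 6, eight ratio regimes, multi-negative allowed: optimum 0 [j018815];
  dual slack `(τ−λ)/6 ∈ {0,1,2,3,4}` (integer redistribution of radical units) [j019053].
* ALL binary cubics |coeff| ≤ 3 and quartics |coeff| ≤ 2 (balanced sub-universe): optimum 0 [j019053];
  structured quartic/cubic universes: optimum 0 [j018836].
* COMPLETE single-negative searches (`rooted_search.py`: root at the positive covering the generic member,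
  match the other two members by node index ∪ small admissible shifts, costs by factoring) in degrees
  2 (|p|,|q| ≤ 3), 3, 4: best value EXACTLY `0 − O(ε)`, never positive; the extremal-zoo recombination
  search (all Belyi-type quartic triples with `U,V` special, 5 ratios): no non-extremal triple has all three
  keys among extremal keys.

## §4 Structural no-go facts for certificates (paper proofs, checked numerically)

* C-PRIVACY.  If `c` is squarefree with no pure factor then `m(c) = c` and the C-line
  `{(a + u·c, b − u·c, c)}` is `{(a,b,c)}`: the C-term of such a triple is private, so it can only carry
  `σ ≥ 0`.  Every NEGATIVE triple of a design has `c` pure-divisible or with a known repeated factor.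
* COUNTING RULE (linear and Fermat-pencil families): with `p_T` = number of pure members,
  `value = Σ σ_T (6 p_T − 12)·deg`, so `Σ_{σ<0} |σ|(2 − p) > Σ_{σ>0} σ (2 − p)`; but a positive of type
  (generic, pure, pure) covering the generic member `x` of a negative forces the negative to be
  `(P₂ − P₁, 2P₁ − P₂, P₁)` (monomials `P₁, P₂`), whose second generic member then needs `3P₁ − P₂` pure —
  impossible for distinct monomials.  Hence the borderline family of §5 is optimal there.
* PENCIL RIEMANN–HURWITZ.  In a single-negative design `N + P_A + P_B + P_C` one has
  `value/6 = 2·deg − Σ r(six other members)`; if both `a` and `b` are generic (squarefree, no pure factor)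
  the four other members `b+ua, c+ua, a+vb, c+vb` lie in the pencil `⟨a,b⟩`, whose total ramification
  `2·deg − 2` forces `Σ r ≥ 2·deg` (at most one member of a pencil is divisible by `U`, one by `V`), while
  `value > 0` needs `Σ r ≤ 2·deg − 2`: impossible (coincidence cases `u, v = ±1` checked separately).  With
  exactly one generic member the same count gives `r(b) + r(c) ≥ deg + 1` and both remaining positives
  Mason–Stothers-tight, i.e. Belyi maps with `U, V` among the special points; their keys carry only
  `±k^deg`-type residue classes (degree 2: `a ≡ ±p²U², ±4p²U² mod ℓ` at a square `ℓ²`), and the exhaustive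
  class arithmetic in degree 2 and the zoo search in degree 4 show these never recombine into a new triple.

## §5 Near misses (value exactly `−O(ε)`)

* every degree `d`: `N = (4U^d − V^d, 2V^d − 4U^d, V^d)`, `P_A = (4U^d − V^d, V^d, 4U^d)` [extremal],
  `P_C = (V^d − 2U^d, 2U^d, V^d)` [extremal], `P_B = (V^d, 2V^d − 4U^d, 3V^d − 4U^d)` [costs exactly the
  gain `6d`]: the B-member `2(V^d − 2U^d)` is generic, its line consists of constant shifts, and the Fermat
  pencil has no cheaper point.  Degree 2 instance: `(8U² − V², 2V² − 8U², V²)` with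
  `P_C = (8U(V−2U), (4U−V)², V²)`.
* the crux's own constants are extremal on `(2^K, 3^J − 2^K, 3^J)`: the lower windows of these balanced
  triples sum to `−ε c₁ K log 2 − O(1)`, so any table is within total slack `ε K log 2 + O(1)` of its lower
  window on ALL their data (near-minimality on Mersenne-type data) — and replacing `6` by any `C < 6`
  makes the sum diverge: §7.

## §6 Line `SketchIdeator1` (picked; lead prover-line-stmt-ABC-14354-0) — status seen by the disprover

All stubs are LANDED (`stub_tlr_iff_itr`, `stub_nearResidueFree_of_pinning`,
`stub_false_of_nearResidueFree` — the last UNCONDITIONALLY, by a Jacobi-symbol/fourth-power certificate),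
and the composition `TameLocalReceptacle_false_of_PinningHypothesis` is landed `--negative-modulo
PinningHypothesis`.  Nothing on the line is refutable: the stubs are theorems.  The hypothesis EH
(`PinningFamilies (1/2^25) A`) is not cheaply refutable either: finiteness/law-of-large-numbers objections
fail (on `X^{1/3}`-smooth families every away-datum has `≫ X/p^{O(1)}` carriers), single-coordinate
equidistribution of friable numbers in fixed residue classes holds with Siegel–Walfisz-quality error
(Fouvry–Tenenbaum), and what EH really asks — that the JOINT law of the other tame data of the ternary
friable family is insensitive, in window-weighted total variation `O(1)`, to the residue class imposed at
`p`, uniformly in `p` — is open (the circle method's `O(1/log y)` relative error is exactly the borderline).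
So the crux is, as of this cycle: refuted modulo EH (line), window-sharp (§7), and immune to finite
symbolic certificates of degree ≤ 4 (§3–§4).

## §7 Tightness (LANDED separately under `Theorems/TameLocalReceptacle/Negative/`)

`TameLocalReceptacleWindowSixTightLemmas.lean` (p117846, ACCEPTED) + `TameLocalReceptacleWindowSixTight.lean`
(p118393): writing `TLRWindow C` for the crux with lower window `c₁ (2(i+j+k) − C − ε) log p` (spelled out in
every statement, no definition), `tlrWindow_six_iff : TLRWindow 6 ↔ TameLocalReceptacle` (`Iff.rfl`),
`tlrWindow_mono`, `not_tlrWindow_of_lt_six : C < 6 → ¬ TLRWindow C` (witness `(2^K, 3^J − 2^K, 3^J)`,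
`κ = 1/10`, `ε = (6 − C)/2`; standard axioms).  Equivalently the slope `2` cannot be raised: the crux sits
exactly on the boundary of its window family, as the Szpiro ratio `→ 6` of these Frey curves dictates.
-/

end Summit.ABC.ABC.Cruxes.TameLocalReceptacle.Disproof
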